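import Summits.Ventures.DiscreteObjects.PP12.FixedIncidenceCounts
import Summits.Ventures.DiscreteObjects.PP12.FixedOffLineBound

/-!
# PP(12): every involution is an elation — the live `|G| = 2` cell, kernel-typed
Framing: lottery ticket; floor = certified bounds/negative ranges.

**Theorem (`elation_of_sq`, `fixedCard_eq_13_of_sq`).** Let `σ ≠ 1` be a collineation of a projective plane of order 12
(Mathlib `Configuration.ProjectivePlane`) with `σ² = 1` on points. Then `σ` is an ELATION: there is a line `l` all of
whose points are fixed (an axis) and a point `c ∈ l` all of whose lines are fixed (a centre); `σ` fixes exactly the 13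
points of `l` and exactly the 13 lines through `c`.

In print this is the standard route "12 is not a square ⇒ no Baer involution ⇒ central (Baer 1946); `n` even ⇒ elation"
(Hughes–Piper, *Projective Planes*, Thms 4.3/4.4; used in AST 2019 §1). Here it is proved WITHOUT subplane / Baer-involution
theory, by counting (cell pub-namedobj, target M; completes the prime-order fixed-structure atlas of
`PrimeOrderSummaryFano` at the prime 2, whose single-involution cell is one of the two LIVE structured cells of PP(12),
|Aut| ∈ {1,2,3} after Akiyama–Suetake–Tanaka 2019/2023):

* `σ² = 1`: a non-fixed point `x` lies on the fixed line `x ∨ σx`, and on no other fixed line (two fixed lines through `x`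
  would fix `x`), so the non-fixed points are partitioned by the fixed lines: `13·g − I = 157 − f`
  (`f`, `g` = numbers of fixed points / lines, `I` = fixed flags), and dually `13·f − I = 157 − g`; hence `f = g`,
  `I = 14f − 157`;
* fixed lines carry an odd number `k ≡ 13 (mod 2)` of fixed points; if no line is an axis then `1 ≤ k ≤ 11`, and
  (`FixedOffLineBound`) `f ≤ 12 + k` for every fixed line; with `Σ k = I`, `Σ k² = I + f(f−1)`
  (`fixed_point_pair_count`) the arithmetic (`involution_arith`) is contradictory: `f ≥ 17` violates `Σ k ≥ f(f−12)`,
  `f ∈ {13, 15}` violate `Σ (k−a)(11−k) ≥ 0` with `a = f − 12`, even `f` violate `f ≡ 157 (mod 2)`;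
* so an axis `l` exists, hence a centre `c` (`exists_center_of_axis`), and `c ∈ l` since a homology of prime order `q`
  needs `q ∣ n − 1 = 11` (`dvd_order_sub_one_of_homology`); the fixed sets are `(l)` and `(c)` by semiregularity.

What is NOT here: the quotient structure (PP(12) with an involutory elation ⇒ symmetric transversal design STD₂[12;6],
Suetake 2002; one exists, Suetake 2009), i.e. no exclusion — the cell stays 'beyond bound k'.
-/

namespace Summit.Ventures.DiscreteObjects.PP12

open Configuration Finset
open scoped Classical

namespace Collineation

variable {P L : Type*} [Membership P L] [ProjectivePlane P L] [Fintype P] [Fintype L]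
  [DecidableEq P] [DecidableEq L] (σ : Collineation P L)

/-! ### General facts for `σ² = 1` and for elations (any order) -/

omit [ProjectivePlane P L] [Fintype P] [Fintype L] [DecidableEq P] [DecidableEq L] in
/-- `σ² = 1`: `σ (σ x) = x`. -/
theorem apply_apply_of_sq (hq : σ.onPoints ^ 2 = 1) (x : P) : σ.onPoints (σ.onPoints x) = x := by
  have := congrArg (fun τ : Equiv.Perm P => τ x) hq
  simpa [pow_two] using this

omit [Fintype P] [Fintype L] [DecidableEq P] [DecidableEq L] in
/-- `σ² = 1`: the line joining a moved point to its image is fixed. -/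
theorem line_fixed_of_sq (hq : σ.onPoints ^ 2 = 1) {x : P} (hx : σ.onPoints x ≠ x) :
    σ.onLines (HasLines.mkLine hx : L) = HasLines.mkLine hx := by
  set m : L := HasLines.mkLine hx
  have h1 : σ.onPoints x ∈ m := (HasLines.mkLine_ax hx).1
  have h2 : x ∈ m := (HasLines.mkLine_ax hx).2
  -- σ m contains σ(σ x) = x and σ x
  have h3 : x ∈ σ.onLines m := by simpa [σ.apply_apply_of_sq hq x] using σ.mem_map h1
  have h4 : σ.onPoints x ∈ σ.onLines m := σ.mem_map h2
  exact (Nondegenerate.eq_or_eq h4 h3 h1 h2).resolve_left hx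

omit [Fintype P] [DecidableEq P] in
/-- `σ² = 1`: a non-fixed point lies on exactly one fixed line. -/
theorem card_fixedLines_through_eq_one_of_sq (hq : σ.onPoints ^ 2 = 1) {x : P} (hx : σ.onPoints x ≠ x) :
    (univ.filter fun m : L => x ∈ m ∧ σ.onLines m = m).card = 1 := by
  rw [Finset.card_eq_one]
  refine ⟨HasLines.mkLine hx, ?_⟩
  ext m
  simp only [mem_filter, mem_univ, true_and, mem_singleton]
  constructor
  · rintro ⟨hxm, fm⟩
    by_contra hne
    exact hx (σ.point_fixed_of_two_fixed hxm (HasLines.mkLine_ax hx).2 hne fm (σ.line_fixed_of_sq hq hx))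
  · rintro rfl
    exact ⟨(HasLines.mkLine_ax hx).2, σ.line_fixed_of_sq hq hx⟩

/-- **Covering count for `σ² = 1`.** The non-fixed points are partitioned by the fixed lines:
`Σ_{fixed m} (n + 1 − k_m) + f = n² + n + 1`. -/
theorem cover_count_of_sq (hq : σ.onPoints ^ 2 = 1) :
    ∑ m ∈ univ.filter (fun m : L => σ.onLines m = m), (ProjectivePlane.order P L + 1 - σ.fixedOnLine m)
      + fixedCard σ.onPoints = ProjectivePlane.order P L ^ 2 + ProjectivePlane.order P L + 1 := by
  set T : Finset L := univ.filter fun m : L => σ.onLines m = m with hT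
  set N : Finset P := univ.filter fun x : P => σ.onPoints x ≠ x with hN
  -- a default line (the type of lines is nonempty)
  have hLpos : 0 < Fintype.card L := by rw [ProjectivePlane.card_lines P L]; positivity
  obtain ⟨l₀⟩ := Fintype.card_pos_iff.mp hLpos
  -- the unique fixed line through a non-fixed point
  let φ : P → L := fun x => if h : σ.onPoints x ≠ x then HasLines.mkLine h else l₀
  have hφ : ∀ x ∈ N, x ∈ φ x ∧ σ.onLines (φ x) = φ x := by
    intro x hx
    have hx' : σ.onPoints x ≠ x := by simpa [hN] using hx
    simp only [φ, dif_pos hx']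
    exact ⟨(HasLines.mkLine_ax hx').2, σ.line_fixed_of_sq hq hx'⟩
  have hmaps : ∀ x ∈ N, φ x ∈ T := fun x hx => by simp [hT, (hφ x hx).2]
  have hfib : ∀ m ∈ T, (N.filter fun x => φ x = m).card = ProjectivePlane.order P L + 1 - σ.fixedOnLine m := by
    intro m hm
    have fm : σ.onLines m = m := by simpa [hT] using hm
    -- the fibre is the set of non-fixed points of m
    have hset : (N.filter fun x => φ x = m) = (univ.filter fun x : P => x ∈ m).filter fun x => σ.onPoints x ≠ x := by
      ext x
      simp only [mem_filter, mem_univ, true_and, hN]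
      constructor
      · rintro ⟨hx, hxm⟩
        exact ⟨by rw [← hxm]; exact (hφ x (by simpa [hN] using hx)).1, hx⟩
      · rintro ⟨hxm, hx⟩
        refine ⟨hx, ?_⟩
        have h1 := σ.card_fixedLines_through_eq_one_of_sq hq hx
        obtain ⟨m₀, hm₀⟩ := Finset.card_eq_one.mp h1
        have e1 : φ x ∈ univ.filter fun m : L => x ∈ m ∧ σ.onLines m = m := by
          simp [(hφ x (by simpa [hN] using hx)).1, (hφ x (by simpa [hN] using hx)).2]
        have e2 : m ∈ univ.filter fun m : L => x ∈ m ∧ σ.onLines m = m := by simp [hxm, fm]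
        rw [hm₀, mem_singleton] at e1 e2
        rw [e1, e2]
    have hall : (univ.filter fun x : P => x ∈ m).card = ProjectivePlane.order P L + 1 := by
      rw [← ProjectivePlane.pointCount_eq P m, Configuration.pointCount, Nat.card_eq_fintype_card,
        Fintype.card_subtype]
    -- fibre = (points of m) minus (fixed points of m)
    have hsub : (univ.filter fun x : P => x ∈ m ∧ σ.onPoints x = x) ⊆ univ.filter fun x : P => x ∈ m :=
      fun x hx => by simp only [mem_filter, mem_univ, true_and] at hx ⊢; exact hx.1
    have hset' : (N.filter fun x => φ x = m)
        = (univ.filter fun x : P => x ∈ m) \ (univ.filter fun x : P => x ∈ m ∧ σ.onPoints x = x) := by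
      rw [hset]; ext x; simp only [mem_filter, mem_univ, true_and, mem_sdiff, not_and]; tauto
    rw [hset', Finset.card_sdiff_of_subset hsub, hall]
    rfl
  have hsum := Finset.card_eq_sum_card_fiberwise hmaps
  rw [Finset.sum_congr rfl hfib] at hsum
  -- N.card + f = v
  have hNf : N.card + fixedCard σ.onPoints = Fintype.card P := by
    unfold fixedCard
    rw [hN, add_comm]
    exact Finset.card_filter_add_card_filter_not (s := (univ : Finset P)) (fun x : P => σ.onPoints x = x)
  rw [ProjectivePlane.card_points P L] at hNf
  rw [← hsum]
  exact hNf

omit [DecidableEq L] in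
/-- **Elations fix exactly the points of the axis**: with axis `l`, centre `c ∈ l` and `σ ≠ 1`, the fixed points are the
`n + 1` points of `l`. -/
theorem fixedCard_eq_of_elation {l : L} {c : P} (hl : σ.IsAxis l) (hc : σ.IsCenter c) (hcl : c ∈ l)
    (hne : σ.onPoints ≠ 1) : fixedCard σ.onPoints = ProjectivePlane.order P L + 1 := by
  unfold fixedCard
  have hset : (univ.filter fun x : P => σ.onPoints x = x) = univ.filter fun x : P => x ∈ l := by
    ext x
    simp only [mem_filter, mem_univ, true_and]
    constructor
    · intro fx
      by_contra hxl
      have hxc : x ≠ c := fun h => hxl (h ▸ hcl)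
      apply hne
      ext s
      simpa using σ.eq_self_of_central_of_fixed hl hc hxl hxc fx s
    · exact hl x
  rw [hset, ← ProjectivePlane.pointCount_eq P l, Configuration.pointCount, Nat.card_eq_fintype_card,
    Fintype.card_subtype]

omit [DecidableEq P] in
/-- **Elations fix exactly the lines through the centre** (dual statement): `n + 1` fixed lines. -/
theorem fixedCard_lines_eq_of_elation {l : L} {c : P} (hl : σ.IsAxis l) (hc : σ.IsCenter c) (hcl : c ∈ l)
    (hne : σ.onPoints ≠ 1) : fixedCard σ.onLines = ProjectivePlane.order P L + 1 := by
  have hneL : σ.dual.onPoints ≠ 1 := fun h => hne (σ.onPoints_eq_one_of_onLines h)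
  have h := σ.dual.fixedCard_eq_of_elation (l := (c : Dual P)) (c := (l : Dual L)) hc hl hcl hneL
  rwa [ProjectivePlane.Dual.order] at h

/-! ### The arithmetic of the no-axis case -/

/-- Pointwise quadratic bound: `a ≤ k ≤ 11` gives `k² + 11a ≤ (a + 11) k`, for `a ∈ {1, 3}`. -/
theorem sq_bound_of_le_eleven {k a : ℕ} (ha : a = 1 ∨ a = 3) (h1 : a ≤ k) (h2 : k ≤ 11) :
    k ^ 2 + 11 * a ≤ (a + 11) * k := by
  rcases ha with rfl | rfl <;> interval_cases k <;> omega

/-- **Arithmetic core.** No family of `f` odd numbers `k_m ∈ [max(1, f − 12), 11]` has `Σ k = 14f − 157` and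
`Σ k² = Σ k + f(f − 1)`. Stated with the sums as hypotheses on a finset of size `f`. -/
theorem involution_arith {ι : Type*} (T : Finset ι) (k : ι → ℕ) (f : ℕ) (hTf : T.card = f) (hodd : f % 2 = 1)
    (hk1 : ∀ m ∈ T, 1 ≤ k m) (hk11 : ∀ m ∈ T, k m ≤ 11) (hkf : ∀ m ∈ T, f ≤ k m + 12)
    (hsum : ∑ m ∈ T, k m + 157 = 14 * f) (hsq : ∑ m ∈ T, k m ^ 2 = ∑ m ∈ T, k m + f * (f - 1)) : False := by
  -- Σ k ≥ f and Σ k ≤ 11 f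
  have hIf : f ≤ ∑ m ∈ T, k m := by
    have := Finset.card_nsmul_le_sum T k 1 hk1
    simpa [hTf] using this
  have hI11 : ∑ m ∈ T, k m ≤ f * 11 := by
    have := Finset.sum_le_card_nsmul T k 11 hk11
    simpa [hTf] using this
  have hf13 : 13 ≤ f := by omega
  have hf52 : f ≤ 52 := by omega
  by_cases hbig : 17 ≤ f
  · -- linear bound: every k ≥ f − 12
    have hlow : ∀ m ∈ T, f - 12 ≤ k m := fun m hm => by have := hkf m hm; omega
    have hlin : f * (f - 12) ≤ ∑ m ∈ T, k m := by
      have := Finset.card_nsmul_le_sum T k (f - 12) hlow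
      simpa [hTf] using this
    -- f (f − 12) ≤ Σ k = 14 f − 157 is impossible for f ≥ 17
    obtain ⟨e, rfl⟩ : ∃ e, f = e + 17 := ⟨f - 17, by omega⟩
    have he : e + 17 - 12 = e + 5 := by omega
    rw [he] at hlin
    nlinarith
  · -- f ∈ {13, 15}: quadratic bound with a = f − 12 ∈ {1, 3}
    have hf : f = 13 ∨ f = 15 := by omega
    have ha : f - 12 = 1 ∨ f - 12 = 3 := by omega
    have hpt : ∀ m ∈ T, k m ^ 2 + 11 * (f - 12) ≤ (f - 12 + 11) * k m := fun m hm =>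
      sq_bound_of_le_eleven ha (by have := hkf m hm; omega) (hk11 m hm)
    have hle := Finset.sum_le_sum hpt
    rw [Finset.sum_add_distrib, Finset.sum_const, hTf, smul_eq_mul, ← Finset.mul_sum] at hle
    rw [hsq] at hle
    rcases hf with rfl | rfl
    · omega
    · omega

/-! ### Order 12 -/

section OrderTwelve

variable (h12 : ProjectivePlane.order P L = 12) (hne : σ.onPoints ≠ 1) (hq : σ.onPoints ^ 2 = 1)
include h12 hne hq

omit [DecidableEq L] hne in
/-- Order 12, `σ² = 1`: every fixed line carries an odd number of fixed points. -/
theorem fixedOnLine_odd_of_sq {l : L} (hl : σ.onLines l = l) : σ.fixedOnLine l % 2 = 1 := by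
  haveI : Fact (Nat.Prime 2) := ⟨by norm_num⟩
  have h1 := σ.fixedOnLine_modEq hl hq
  rw [h12] at h1
  unfold Nat.ModEq at h1
  omega

/-- **Order 12: an involution has an axis.** -/
theorem exists_axis_of_sq : ∃ l : L, σ.IsAxis l := by
  haveI : Fact (Nat.Prime 2) := ⟨by norm_num⟩
  by_contra hax
  push Not at hax
  set S : Finset P := univ.filter fun x : P => σ.onPoints x = x with hS
  set T : Finset L := univ.filter fun m : L => σ.onLines m = m with hT
  have hSdef : fixedCard σ.onPoints = S.card := rfl
  have hTdef : fixedCard σ.onLines = T.card := rfl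
  -- parity of f
  have hfodd : S.card % 2 = 1 := by
    have h := σ.card_fixedPoints_modEq_card hq
    rw [h12] at h; unfold Nat.ModEq at h; norm_num at h; rw [← hSdef]; omega
  -- no axis: every fixed line has k ≤ 11 (odd and ≠ 13)
  have hk13 : ∀ m ∈ T, σ.fixedOnLine m ≤ 13 := fun m _ => by
    have := σ.fixedOnLine_le m; rw [h12] at this; exact this
  have hk11 : ∀ m ∈ T, σ.fixedOnLine m ≤ 11 := by
    intro m hm
    have fm : σ.onLines m = m := by simpa [hT] using hm
    have hodd := σ.fixedOnLine_odd_of_sq h12 hq fm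
    have h13 := hk13 m hm
    by_contra h
    have heq : σ.fixedOnLine m = 13 := by omega
    exact hax m (σ.isAxis_of_fixedOnLine_eq (by rw [heq, h12]))
  have hk1 : ∀ m ∈ T, 1 ≤ σ.fixedOnLine m := by
    intro m hm
    have fm : σ.onLines m = m := by simpa [hT] using hm
    have := σ.fixedOnLine_odd_of_sq h12 hq fm
    omega
  -- dual hypotheses
  have h12' : ProjectivePlane.order (Dual L) (Dual P) = 12 := by rw [ProjectivePlane.Dual.order]; exact h12
  have hneL : σ.dual.onPoints ≠ 1 := fun h => hne (σ.onPoints_eq_one_of_onLines h)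
  have hqL : σ.dual.onPoints ^ 2 = 1 := σ.onLines_pow_eq_one hq
  -- covering counts: 13 g − I + f = 157 and 13 f − I + g = 157
  have hA := σ.cover_count_of_sq hq
  rw [h12] at hA
  have hB := σ.dual.cover_count_of_sq hqL
  rw [h12'] at hB
  -- the dual count in primal terms (definitional)
  have hBsum : ∑ m ∈ univ.filter (fun m : Dual P => σ.dual.onLines m = m), (12 + 1 - σ.dual.fixedOnLine m)
      = ∑ p ∈ S, (12 + 1 - σ.fixedThrough p) :=
    Finset.sum_congr rfl fun p _ => by rw [fixedThrough_eq_dual]; rfl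
  rw [hBsum] at hB
  change ∑ p ∈ S, (12 + 1 - σ.fixedThrough p) + T.card = _ at hB
  change ∑ m ∈ T, (12 + 1 - σ.fixedOnLine m) + S.card = _ at hA
  -- flags
  have hflag : ∑ p ∈ S, σ.fixedThrough p = ∑ m ∈ T, σ.fixedOnLine m := σ.fixed_flag_count
  have ht13 : ∀ p ∈ S, σ.fixedThrough p ≤ 13 := fun p _ => by
    have := σ.fixedThrough_le p; rw [h12] at this; exact this
  -- turn truncated subtractions into equations
  have hA' : ∑ m ∈ T, (12 + 1 - σ.fixedOnLine m) + ∑ m ∈ T, σ.fixedOnLine m = 13 * T.card := by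
    rw [← Finset.sum_add_distrib, Finset.sum_congr rfl (fun m hm => Nat.sub_add_cancel (hk13 m hm)),
      Finset.sum_const, smul_eq_mul, mul_comm]
  have hB' : ∑ p ∈ S, (12 + 1 - σ.fixedThrough p) + ∑ p ∈ S, σ.fixedThrough p = 13 * S.card := by
    rw [← Finset.sum_add_distrib, Finset.sum_congr rfl (fun p hp => Nat.sub_add_cancel (ht13 p hp)),
      Finset.sum_const, smul_eq_mul, mul_comm]
  -- f = g and I + 157 = 14 f
  have hfg : T.card = S.card := by omega
  have hIsum : ∑ m ∈ T, σ.fixedOnLine m + 157 = 14 * S.card := by omega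
  -- pairs of fixed points
  have hsq : ∑ m ∈ T, σ.fixedOnLine m ^ 2 = ∑ m ∈ T, σ.fixedOnLine m + S.card * (S.card - 1) := by
    rw [← hflag]; exact σ.fixed_point_pair_count
  -- Bruck-type bound on every fixed line
  have hkf : ∀ m ∈ T, S.card ≤ σ.fixedOnLine m + 12 := by
    intro m hm
    have fm : σ.onLines m = m := by simpa [hT] using hm
    -- a non-fixed point X ∈ m exists since k_m ≤ 11 < 13
    have hlpts : (univ.filter fun x : P => x ∈ m).card = 13 := by
      rw [← Fintype.card_subtype, ← Nat.card_eq_fintype_card]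
      change Configuration.pointCount P m = 13
      rw [ProjectivePlane.pointCount_eq P m, h12]
    obtain ⟨X, hXm, hXnot⟩ : ∃ X : P, X ∈ m ∧ σ.onPoints X ≠ X := by
      by_contra h
      push Not at h
      have hsub : (univ.filter fun x : P => x ∈ m) ⊆ univ.filter fun x => x ∈ m ∧ σ.onPoints x = x :=
        fun x hx => by simp only [mem_filter, mem_univ, true_and] at hx ⊢; exact ⟨hx, h x hx⟩
      have := Finset.card_le_card hsub
      have h11 := hk11 m hm
      unfold fixedOnLine at h11
      rw [hlpts] at this
      omega
    have hoff := σ.card_fixed_off_line_le_order fm hXm hXnot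
    rw [h12] at hoff
    have hon : (S.filter fun x => x ∈ m).card = σ.fixedOnLine m := by
      unfold fixedOnLine; congr 1; ext x; simp [hS, and_comm]
    have hsplit := Finset.card_filter_add_card_filter_not (s := S) (fun x : P => x ∈ m)
    have hoff' : (S.filter fun x => x ∉ m).card ≤ 12 := by
      convert hoff using 2; ext x; simp [hS]
    omega
  exact involution_arith T (fun m => σ.fixedOnLine m) S.card hfg hfodd hk1 hk11 hkf hIsum hsq

/-- **Order 12: every involution is an elation** — an axis `l` and a centre `c` on it. -/
theorem elation_of_sq : ∃ (l : L) (c : P), σ.IsAxis l ∧ σ.IsCenter c ∧ c ∈ l := by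
  haveI : Fact (Nat.Prime 2) := ⟨by norm_num⟩
  obtain ⟨l, hl⟩ := σ.exists_axis_of_sq h12 hne hq
  obtain ⟨c, hc⟩ := σ.exists_center_of_axis hl
  refine ⟨l, c, hl, hc, ?_⟩
  by_contra hcl
  have h := σ.dvd_order_sub_one_of_homology hl hc hcl hne hq
  rw [h12] at h
  revert h; decide

/-- **Order 12: an involution fixes exactly 13 points and exactly 13 lines** (the axis and the pencil of the centre). -/
theorem fixedCard_eq_13_of_sq : fixedCard σ.onPoints = 13 ∧ fixedCard σ.onLines = 13 := by
  obtain ⟨l, c, hl, hc, hcl⟩ := σ.elation_of_sq h12 hne hq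
  exact ⟨by rw [σ.fixedCard_eq_of_elation hl hc hcl hne, h12],
    by rw [σ.fixedCard_lines_eq_of_elation hl hc hcl hne, h12]⟩

end OrderTwelve

end Collineation

end Summit.Ventures.DiscreteObjects.PP12
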